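import Mathlib
import HarnessLib
import Literature.MathematicalPhysics.StatisticalMechanics.RenormalisationMapTwoKernelRaw
import Literature.MathematicalPhysics.StatisticalMechanics.RenormalisationMapDecompositionFreeHt
import Literature.MathematicalPhysics.StatisticalMechanics.RenormalisationMapBlockDefect

/-!
# `K_{k+1}` with a FREE intermediate Hamiltonian vs. the renormalisation map: glue and RAW per-polymer bound
# `‖nextK(μ_D; e^{−H}, e^{−H̃}, K)(U) − S(H,K)(U)‖_{k+1,U} ≤ Σᵢ cᵢ(‖H̃ − H_{k+1}‖_{k,0})` ([ABKM19] Thm 6.8 ⊗ Lemma 9.3)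

The free-`H̃` decomposition (`RenormalisationMapDecompositionFreeHt`) and the tied one (`RenormalisationMapRemaindersOneQ`) at the
SAME step data `D` and state `(H, K)` differ by the `H̃`-variation of the four remainders and by the single-block defect:
`nextK(μ_D; e^{−H}, e^{−H̃}, K)(U) − nextKStep D H K (U) = Σᵢ [Σᵢ(D; H̃) − Σᵢ(D; H_{k+1})] + Σ₀(H̃)`, `H_{k+1} = nextH D H K`.
Each bracket is an instance of the LANDED one-kernel Lipschitz theorems of the remainders with `H' = H`, `K' = K`, `C_Δ = 0`
and the free pair `(H̃, H_{k+1})` in the prefactor slot (`RenormalisationMapRemaindersOneQ/TwoQ`), the defect is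
`RenormalisationMapBlockDefect.tayNormLE_blockDefect_sub_abkm`; every constant carries the factor
`Δ_t = 16e^{3/8}‖H̃ − H_{k+1}‖_{k,0}`.

* `tayNormLE_nextK_freeHt_sub_nextKStep_of_pieces` — the GLUE: five piece bounds with arbitrary constants `c₁,…,c₅` give the
  bound `c₁ + ⋯ + c₅` for `nextK(…e^{−H̃}…)(U) − nextKStep D H K U` (smoothness bookkeeping and both decompositions discharged);
* `tayNormLE_nextK_freeHt_sub_nextKStep_abkm_raw_of_stepKernelBounds` — the RAW bound with the explicit constants of the four
  one-kernel Lipschitz theorems (letters `τ, ω, κ, κ₁` as in `RenormalisationMapTwoKernelRaw`, `Δ_t` explicit) plus the defect.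

This is the per-polymer form of the free-`H̃` UNIFORM bound (U1) of the blocks B1–B3 of the stub `stub_f4l2ShrinkLoc` (second-order
two-kernel slot (F4l2), [ABKM19] Lemma 12.6 (12.53) at `ℓ = 2`): on a ball `‖H̃ − H_{k+1}‖_{k,0} ≤ ρ₀` the map
`H̃ ↦ nextK(μ_D; e^{−H}, e^{−H̃}, K)` is within `O(ρ₀)` of `S(H,K)` in the `T_{k+1}^{U*}`-norms, hence uniformly bounded after the
weak-norm conversion (next file of the line).  Everything is proved; no named fact.  Honest scope: rung route
`Summits/HubbardSuperconductivity/…/Theses/ComplexGFFStiffness` (stiffness of a complex Gaussian gradient field via the [ABKM19] RG);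
nothing about superconductivity in the Hubbard model is claimed or advanced.

## References
* S. Adams, S. Buchholz, R. Kotecký, S. Müller, arXiv:1910.13564, Theorem 6.8 ((6.59)–(6.60)), Lemma 9.3, Lemma 9.6, Ch. 10.1,
  Lemma 12.6 (12.53) [AdamsBuchholzKoteckyMuller2019].
-/

noncomputable section

namespace Literature.MathematicalPhysics.StatisticalMechanics.GradientRG

open scoped BigOperators Classical
open Finset MeasureTheory
open Literature.MathematicalPhysics.StatisticalMechanics.TorusPolymer
  (IsPolymer blocks polys bprod blockOf thicken reblock boxCorner mem_polys mem_blocks numBlocks isPolymer_blockOf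
    card_blocks_eq_numBlocks blocks_blockOf empty_mem_polys closure mem_blockOf_self)
open Literature.Barriers.CriticalPhenomena.LongRangePhi4.Polymer (IsConn components)
open Literature.MathematicalPhysics.StatisticalMechanics.GradientFRD (iterDiff)
open Literature.MathematicalPhysics.QuantumFieldTheory

variable {d M : ℕ} [NeZero M]

set_option maxHeartbeats 1600000 in
/-- **Glue (free `H̃` vs. tied).** Five piece bounds — the `H̃`-variations of `Σ₁, Σ₂ᴸ, Σ₃, Σ₄` between `H̃` and `H_{k+1} = nextH D H K`
and the single-block defect — with constants `c₁,…,c₅` give `‖nextK(μ_D; e^{−H}, e^{−H̃}, K)(U) − nextKStep D H K U‖ ≤ c₁+⋯+c₅`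
(torus data, `D.s = L^k`, `D.L = L`, `‖H‖_{k,0} ≤ 1/8`, admissible `K` with `K(∅) = 1`, `U ≠ ∅`).
[cite: AdamsBuchholzKoteckyMuller2019, Theorem 6.8 / Ch. 9.1 / Ch. 10.1] -/
theorem tayNormLE_nextK_freeHt_sub_nextKStep_of_pieces {L N Mord R n p r₀ : ℕ}
    {θbar lam μ δ₁ δ₀ A𝒫 A𝒫a C₂a h A : ℝ}
    {𝒞 : ℕ → (Fin d → ZMod M) → ℝ} (hd : 2 ≤ d) (hLodd : Odd L) (hL : 2 ^ (d + 3) + 16 * R ≤ L)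
    (hM : M = L ^ N) {k : ℕ} (hkN : k + 1 ≤ N) (hp : d / 2 + 1 ≤ p) (hpR : p ≤ R) (hMord : d / 2 + 1 ≤ Mord)
    (hB : AbkmWeightBounds L N Mord R n θbar lam μ δ₁ δ₀ A𝒫 𝒞
      (abkmWeightData L N Mord R θbar (schedDelta δ₀ δ₁ N) 𝒞))
    (hδ₀ : 0 < δ₀) (hδ₁ : 0 < δ₁) (hh : 0 < h) (hh0 : hZeroSq d R δ₀ δ₁ ≤ h ^ 2) (hA : 0 < A)
    (D : StepData d M) (hDs : D.s = L ^ k) (hDL : D.L = L)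
    (hS : StepKernelBounds (abkmWeightData L N Mord R θbar (schedDelta δ₀ δ₁ N) 𝒞) L k A𝒫a C₂a D.𝒞)
    {x₀ : Fin d → ZMod M} (hB₀ : D.B₀ = blockOf (L ^ k) x₀) (hc₀ : D.c₀ = boxCorner (L ^ k) (starRad R L d k) x₀)
    {H : RelevantHamiltonian ℂ d}
    (hH : hamNorm (fieldWt h (L : ℝ) d k) ((L : ℝ) ^ k) (L ^ (d * k)) H ≤ 1 / 8)
    (Ht : RelevantHamiltonian ℂ d)
    {K : Finset (Fin d → ZMod M) → ((Fin d → ZMod M) → ℝ) → ℂ} {C : ℝ} (hC : 0 ≤ C)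
    (hK : WeakNormLE (abkmNormParams L N Mord R p r₀ h θbar A (schedDelta δ₀ δ₁ N) 𝒞) k K C)
    (hKfac : Factorises (L ^ k) K) (hK0 : ∀ φ, K ∅ φ = 1) (hKd : ∀ Y, ContDiff ℝ r₀ (K Y))
    (hKloc : ∀ Y, IsPolymer (L ^ k) Y → IsConn Y →
      IsGaugeLocal ((abkmNormParams L N Mord R p r₀ h θbar A (schedDelta δ₀ δ₁ N) 𝒞).gauge k Y) (K Y))
    {U : Finset (Fin d → ZMod M)} (hUne : U.Nonempty)
    {c₁ c₂ c₃ c₄ c₅ : ℝ}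
    (h1 : TayNormLE ((abkmNormParams L N Mord R p r₀ h θbar A (schedDelta δ₀ δ₁ N) 𝒞).gauge (k + 1) U) r₀
      ((abkmWeightData L N Mord R θbar (schedDelta δ₀ δ₁ N) 𝒞).weight (k + 1) U)
      (fun φ => (∑ B ∈ blockPartIndex D U,
        ((bprod (L ^ k) (fun B' => expNegH (Ht) B' φ) (U \ B) *
              bprod (L ^ k) (fun B' => expNegH (-(Ht)) B' φ) (B \ U) - 1) * blockTerm D K B φ +
          bprod (L ^ k) (fun B' => expNegH (Ht) B' φ) (U \ B) *
              bprod (L ^ k) (fun B' => expNegH (-(Ht)) B' φ) (B \ U) *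
            (fluctDefect D.𝒞 H B φ +
              (expNegH (stepOpA (gradCov D.𝒞) H) B φ - 1) * (1 - Complex.exp (-(eval (opB D K) B φ))) -
              (Complex.exp (-(eval (opB D K) B φ)) - 1 + eval (opB D K) B φ)) +
          bprod (L ^ k) (fun B' => expNegH (Ht) B' φ) (U \ B) *
              bprod (L ^ k) (fun B' => expNegH (-(Ht)) B' φ) (B \ U) *
            fluct D.𝒞 (fun ψ => ∑ Y ∈ ((polys (L ^ k) B).erase B).erase ∅,
              bprod (L ^ k) (fun B' => expNegH H B' ψ - 1) (B \ Y) * K Y ψ) φ)) -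
        (∑ B ∈ blockPartIndex D U,
        ((bprod (L ^ k) (fun B' => expNegH (nextH D H K) B' φ) (U \ B) *
              bprod (L ^ k) (fun B' => expNegH (-(nextH D H K)) B' φ) (B \ U) - 1) * blockTerm D K B φ +
          bprod (L ^ k) (fun B' => expNegH (nextH D H K) B' φ) (U \ B) *
              bprod (L ^ k) (fun B' => expNegH (-(nextH D H K)) B' φ) (B \ U) *
            (fluctDefect D.𝒞 H B φ +
              (expNegH (stepOpA (gradCov D.𝒞) H) B φ - 1) * (1 - Complex.exp (-(eval (opB D K) B φ))) -
              (Complex.exp (-(eval (opB D K) B φ)) - 1 + eval (opB D K) B φ)) +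
          bprod (L ^ k) (fun B' => expNegH (nextH D H K) B' φ) (U \ B) *
              bprod (L ^ k) (fun B' => expNegH (-(nextH D H K)) B' φ) (B \ U) *
            fluct D.𝒞 (fun ψ => ∑ Y ∈ ((polys (L ^ k) B).erase B).erase ∅,
              bprod (L ^ k) (fun B' => expNegH H B' ψ - 1) (B \ Y) * K Y ψ) φ))) c₁)
    (h2 : TayNormLE ((abkmNormParams L N Mord R p r₀ h θbar A (schedDelta δ₀ δ₁ N) 𝒞).gauge (k + 1) U) r₀
      ((abkmWeightData L N Mord R θbar (schedDelta δ₀ δ₁ N) 𝒞).weight (k + 1) U)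
      (fun φ => ∑ X ∈ largePartIndex (L ^ k) L U,
        ((bprod (L ^ k) (fun B => expNegH (Ht) B φ) (U \ X) * bprod (L ^ k) (fun B => expNegH (-(Ht)) B φ) (X \ U) *
            (fluct D.𝒞 (polyP2 (L ^ k) H K X) φ + bprod (L ^ k) (fun B => 1 - expNegH (Ht) B φ) X)) -
          (bprod (L ^ k) (fun B => expNegH (nextH D H K) B φ) (U \ X) * bprod (L ^ k) (fun B => expNegH (-(nextH D H K)) B φ) (X \ U) *
            (fluct D.𝒞 (polyP2 (L ^ k) H K X) φ + bprod (L ^ k) (fun B => 1 - expNegH (nextH D H K) B φ) X)))) c₂)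
    (h3 : TayNormLE ((abkmNormParams L N Mord R p r₀ h θbar A (schedDelta δ₀ δ₁ N) 𝒞).gauge (k + 1) U) r₀
      ((abkmWeightData L N Mord R θbar (schedDelta δ₀ δ₁ N) 𝒞).weight (k + 1) U)
      (fun φ => ∑ X ∈ ((polys (L ^ k) univ).filter (fun X => reblock (L ^ k) (L * L ^ k) X = U)).filter
          (fun X => ¬ IsConn X),
        ((bprod (L ^ k) (fun B => expNegH (Ht) B φ) (U \ X) * bprod (L ^ k) (fun B => expNegH (-(Ht)) B φ) (X \ U) *
            (fluct D.𝒞 (polyP2 (L ^ k) H K X) φ + bprod (L ^ k) (fun B => 1 - expNegH (Ht) B φ) X)) -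
          (bprod (L ^ k) (fun B => expNegH (nextH D H K) B φ) (U \ X) * bprod (L ^ k) (fun B => expNegH (-(nextH D H K)) B φ) (X \ U) *
            (fluct D.𝒞 (polyP2 (L ^ k) H K X) φ + bprod (L ^ k) (fun B => 1 - expNegH (nextH D H K) B φ) X)))) c₃)
    (h4 : TayNormLE ((abkmNormParams L N Mord R p r₀ h θbar A (schedDelta δ₀ δ₁ N) 𝒞).gauge (k + 1) U) r₀
      ((abkmWeightData L N Mord R θbar (schedDelta δ₀ δ₁ N) 𝒞).weight (k + 1) U)
      (fun φ => ∑ X ∈ (polys (L ^ k) univ).filter (fun X => reblock (L ^ k) (L * L ^ k) X = U),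
        ∑ X₁ ∈ ((polys (L ^ k) X).erase X).erase ∅,
        ((bprod (L ^ k) (fun B => expNegH (Ht) B φ) (U \ X) * bprod (L ^ k) (fun B => expNegH (-(Ht)) B φ) (X \ U) *
            (bprod (L ^ k) (fun B => 1 - expNegH (Ht) B φ) X₁ * fluct D.𝒞 (polyP2 (L ^ k) H K (X \ X₁)) φ)) -
          (bprod (L ^ k) (fun B => expNegH (nextH D H K) B φ) (U \ X) * bprod (L ^ k) (fun B => expNegH (-(nextH D H K)) B φ) (X \ U) *
            (bprod (L ^ k) (fun B => 1 - expNegH (nextH D H K) B φ) X₁ * fluct D.𝒞 (polyP2 (L ^ k) H K (X \ X₁)) φ)))) c₄)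
    (h5 : TayNormLE ((abkmNormParams L N Mord R p r₀ h θbar A (schedDelta δ₀ δ₁ N) 𝒞).gauge (k + 1) U) r₀
      ((abkmWeightData L N Mord R θbar (schedDelta δ₀ δ₁ N) 𝒞).weight (k + 1) U)
      (fun φ => ∑ B ∈ blockPartIndex D U,
        bprod (L ^ k) (fun B' => expNegH Ht B' φ) (U \ B) *
            bprod (L ^ k) (fun B' => expNegH (-Ht) B' φ) (B \ U) *
          (expNegH (nextH D H K) B φ - expNegH Ht B φ)) c₅) :
    TayNormLE ((abkmNormParams L N Mord R p r₀ h θbar A (schedDelta δ₀ δ₁ N) 𝒞).gauge (k + 1) U) r₀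
      ((abkmWeightData L N Mord R θbar (schedDelta δ₀ δ₁ N) 𝒞).weight (k + 1) U)
      (fun φ => nextK D.s (reblock D.s (D.L * D.s)) (stepMeasure D.𝒞) (expNegH H) (expNegH Ht) K U φ - nextKStep D H K U φ)
      (c₁ + c₂ + c₃ + c₄ + c₅) := by
  have hk1 : k + 1 ≤ N + 1 := by omega
  have hMo : Odd M := by rw [hM]; exact hLodd.pow
  have hsodd : Odd (L ^ k) := hLodd.pow
  -- smoothness of the single-data functionals
  have hUk : ∀ X ∈ ((polys (L ^ k) univ).filter (fun X => reblock (L ^ k) (L * L ^ k) X = U)), IsPolymer (L ^ k) X :=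
    fun X hX => (mem_polys.1 (mem_filter.1 hX).1).2
  have hblk : ∀ B ∈ blockPartIndex D U, ∃ y, B = blockOf (L ^ k) y := fun B hB' => by
    have hBb := blockPartIndex_subset_blocks D U hB'
    rw [hDs] at hBb
    obtain ⟨y, -, rfl⟩ := mem_blocks.1 hBb
    exact ⟨y, rfl⟩
  have hS1d : ∀ (Ht : RelevantHamiltonian ℂ d), ContDiff ℝ r₀ (fun φ : (Fin d → ZMod M) → ℝ => (∑ B ∈ blockPartIndex D U,
        ((bprod (L ^ k) (fun B' => expNegH (Ht) B' φ) (U \ B) *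
              bprod (L ^ k) (fun B' => expNegH (-(Ht)) B' φ) (B \ U) - 1) * blockTerm D K B φ +
          bprod (L ^ k) (fun B' => expNegH (Ht) B' φ) (U \ B) *
              bprod (L ^ k) (fun B' => expNegH (-(Ht)) B' φ) (B \ U) *
            (fluctDefect D.𝒞 H B φ +
              (expNegH (stepOpA (gradCov D.𝒞) H) B φ - 1) * (1 - Complex.exp (-(eval (opB D K) B φ))) -
              (Complex.exp (-(eval (opB D K) B φ)) - 1 + eval (opB D K) B φ)) +
          bprod (L ^ k) (fun B' => expNegH (Ht) B' φ) (U \ B) *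
              bprod (L ^ k) (fun B' => expNegH (-(Ht)) B' φ) (B \ U) *
            fluct D.𝒞 (fun ψ => ∑ Y ∈ ((polys (L ^ k) B).erase B).erase ∅,
              bprod (L ^ k) (fun B' => expNegH H B' ψ - 1) (B \ Y) * K Y ψ) φ))) := by
    intro Ht
    refine ContDiff.sum fun B hB' => ?_
    obtain ⟨y, rfl⟩ := hblk B hB'
    exact contDiff_blockSummand_abkm_of_stepKernelBounds (p := p) (r₀ := r₀) (A := A) hd hB hLodd hM hkN hδ₀ hδ₁ hh hh0 hMord hp
      hA D hS y Ht hH hC hK hKd hKloc U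
  have hT2d : ∀ (Ht : RelevantHamiltonian ℂ d) (X : Finset (Fin d → ZMod M)), IsPolymer (L ^ k) X →
      ContDiff ℝ r₀ (fun φ : (Fin d → ZMod M) → ℝ =>
        bprod (L ^ k) (fun B => expNegH (Ht) B φ) (U \ X) * bprod (L ^ k) (fun B => expNegH (-(Ht)) B φ) (X \ U) *
            (fluct D.𝒞 (polyP2 (L ^ k) H K X) φ + bprod (L ^ k) (fun B => 1 - expNegH (Ht) B φ) X)) :=
    fun Ht X hXp =>
      contDiff_reblockTop_abkm_of_stepKernelBounds hd hLodd hM hkN hS hp hMord hB hδ₀ hδ₁ hh hh0 hA hXp Ht hH hC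
        hK hKfac hK0 hKd hKloc U
  have hT4d : ∀ (Ht : RelevantHamiltonian ℂ d) (X : Finset (Fin d → ZMod M)), IsPolymer (L ^ k) X →
      ∀ X₁ ∈ polys (L ^ k) X,
      ContDiff ℝ r₀ (fun φ : (Fin d → ZMod M) → ℝ =>
        bprod (L ^ k) (fun B => expNegH (Ht) B φ) (U \ X) * bprod (L ^ k) (fun B => expNegH (-(Ht)) B φ) (X \ U) *
            (bprod (L ^ k) (fun B => 1 - expNegH (Ht) B φ) X₁ * fluct D.𝒞 (polyP2 (L ^ k) H K (X \ X₁)) φ)) :=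
    fun Ht X hXp X₁ hX₁ =>
      contDiff_reblockSub_abkm_of_stepKernelBounds hd hLodd hM hkN hS hp hMord hB hδ₀ hδ₁ hh hh0 hA hXp hX₁ Ht hH
        hC hK hKfac hK0 hKd hKloc U
  have hcdE : ∀ (H₀ : RelevantHamiltonian ℂ d) (Z : Finset (Fin d → ZMod M)),
      ContDiff ℝ r₀ (fun φ : (Fin d → ZMod M) → ℝ => bprod (L ^ k) (fun B => expNegH H₀ B φ) Z) := by
    intro H₀ Z
    unfold TorusPolymer.bprod
    exact contDiff_prod fun B _ => (contDiff_eval H₀ B (n := r₀)).neg.cexp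
  have hexpd : ∀ (H₀ : RelevantHamiltonian ℂ d) (B : Finset (Fin d → ZMod M)), ContDiff ℝ r₀ (expNegH H₀ B) := by
    intro H₀ B
    show ContDiff ℝ r₀ (fun φ : (Fin d → ZMod M) → ℝ => Complex.exp (-(eval H₀ B φ)))
    exact (contDiff_eval H₀ B (n := r₀)).neg.cexp
  have hF1d : ContDiff ℝ r₀ (fun φ => (∑ B ∈ blockPartIndex D U,
        ((bprod (L ^ k) (fun B' => expNegH (Ht) B' φ) (U \ B) *
              bprod (L ^ k) (fun B' => expNegH (-(Ht)) B' φ) (B \ U) - 1) * blockTerm D K B φ +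
          bprod (L ^ k) (fun B' => expNegH (Ht) B' φ) (U \ B) *
              bprod (L ^ k) (fun B' => expNegH (-(Ht)) B' φ) (B \ U) *
            (fluctDefect D.𝒞 H B φ +
              (expNegH (stepOpA (gradCov D.𝒞) H) B φ - 1) * (1 - Complex.exp (-(eval (opB D K) B φ))) -
              (Complex.exp (-(eval (opB D K) B φ)) - 1 + eval (opB D K) B φ)) +
          bprod (L ^ k) (fun B' => expNegH (Ht) B' φ) (U \ B) *
              bprod (L ^ k) (fun B' => expNegH (-(Ht)) B' φ) (B \ U) *
            fluct D.𝒞 (fun ψ => ∑ Y ∈ ((polys (L ^ k) B).erase B).erase ∅,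
              bprod (L ^ k) (fun B' => expNegH H B' ψ - 1) (B \ Y) * K Y ψ) φ)) -
        (∑ B ∈ blockPartIndex D U,
        ((bprod (L ^ k) (fun B' => expNegH (nextH D H K) B' φ) (U \ B) *
              bprod (L ^ k) (fun B' => expNegH (-(nextH D H K)) B' φ) (B \ U) - 1) * blockTerm D K B φ +
          bprod (L ^ k) (fun B' => expNegH (nextH D H K) B' φ) (U \ B) *
              bprod (L ^ k) (fun B' => expNegH (-(nextH D H K)) B' φ) (B \ U) *
            (fluctDefect D.𝒞 H B φ +
              (expNegH (stepOpA (gradCov D.𝒞) H) B φ - 1) * (1 - Complex.exp (-(eval (opB D K) B φ))) -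
              (Complex.exp (-(eval (opB D K) B φ)) - 1 + eval (opB D K) B φ)) +
          bprod (L ^ k) (fun B' => expNegH (nextH D H K) B' φ) (U \ B) *
              bprod (L ^ k) (fun B' => expNegH (-(nextH D H K)) B' φ) (B \ U) *
            fluct D.𝒞 (fun ψ => ∑ Y ∈ ((polys (L ^ k) B).erase B).erase ∅,
              bprod (L ^ k) (fun B' => expNegH H B' ψ - 1) (B \ Y) * K Y ψ) φ))) := (hS1d Ht).sub (hS1d (nextH D H K))
  have hF2d : ContDiff ℝ r₀ (fun φ => ∑ X ∈ largePartIndex (L ^ k) L U,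
        ((bprod (L ^ k) (fun B => expNegH (Ht) B φ) (U \ X) * bprod (L ^ k) (fun B => expNegH (-(Ht)) B φ) (X \ U) *
            (fluct D.𝒞 (polyP2 (L ^ k) H K X) φ + bprod (L ^ k) (fun B => 1 - expNegH (Ht) B φ) X)) -
          (bprod (L ^ k) (fun B => expNegH (nextH D H K) B φ) (U \ X) * bprod (L ^ k) (fun B => expNegH (-(nextH D H K)) B φ) (X \ U) *
            (fluct D.𝒞 (polyP2 (L ^ k) H K X) φ + bprod (L ^ k) (fun B => 1 - expNegH (nextH D H K) B φ) X)))) := by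
    refine ContDiff.sum fun X hX => ?_
    obtain ⟨hXp, -, -, -⟩ := mem_largePartIndex.1 hX
    exact (hT2d Ht X hXp).sub (hT2d (nextH D H K) X hXp)
  have hF3d : ContDiff ℝ r₀ (fun φ => ∑ X ∈ ((polys (L ^ k) univ).filter (fun X => reblock (L ^ k) (L * L ^ k) X = U)).filter
          (fun X => ¬ IsConn X),
        ((bprod (L ^ k) (fun B => expNegH (Ht) B φ) (U \ X) * bprod (L ^ k) (fun B => expNegH (-(Ht)) B φ) (X \ U) *
            (fluct D.𝒞 (polyP2 (L ^ k) H K X) φ + bprod (L ^ k) (fun B => 1 - expNegH (Ht) B φ) X)) -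
          (bprod (L ^ k) (fun B => expNegH (nextH D H K) B φ) (U \ X) * bprod (L ^ k) (fun B => expNegH (-(nextH D H K)) B φ) (X \ U) *
            (fluct D.𝒞 (polyP2 (L ^ k) H K X) φ + bprod (L ^ k) (fun B => 1 - expNegH (nextH D H K) B φ) X)))) := by
    refine ContDiff.sum fun X hX => ?_
    have hXp := hUk X (mem_filter.1 hX).1
    exact (hT2d Ht X hXp).sub (hT2d (nextH D H K) X hXp)
  have hF4d : ContDiff ℝ r₀ (fun φ => ∑ X ∈ (polys (L ^ k) univ).filter (fun X => reblock (L ^ k) (L * L ^ k) X = U),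
        ∑ X₁ ∈ ((polys (L ^ k) X).erase X).erase ∅,
        ((bprod (L ^ k) (fun B => expNegH (Ht) B φ) (U \ X) * bprod (L ^ k) (fun B => expNegH (-(Ht)) B φ) (X \ U) *
            (bprod (L ^ k) (fun B => 1 - expNegH (Ht) B φ) X₁ * fluct D.𝒞 (polyP2 (L ^ k) H K (X \ X₁)) φ)) -
          (bprod (L ^ k) (fun B => expNegH (nextH D H K) B φ) (U \ X) * bprod (L ^ k) (fun B => expNegH (-(nextH D H K)) B φ) (X \ U) *
            (bprod (L ^ k) (fun B => 1 - expNegH (nextH D H K) B φ) X₁ * fluct D.𝒞 (polyP2 (L ^ k) H K (X \ X₁)) φ)))) := by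
    refine ContDiff.sum fun X hX => ContDiff.sum fun X₁ hX₁ => ?_
    have hXp := hUk X hX
    have hX₁p : X₁ ∈ polys (L ^ k) X := mem_of_mem_erase (mem_of_mem_erase hX₁)
    exact (hT4d Ht X hXp X₁ hX₁p).sub (hT4d (nextH D H K) X hXp X₁ hX₁p)
  have hF5d : ContDiff ℝ r₀ (fun φ => ∑ B ∈ blockPartIndex D U,
        bprod (L ^ k) (fun B' => expNegH Ht B' φ) (U \ B) *
            bprod (L ^ k) (fun B' => expNegH (-Ht) B' φ) (B \ U) *
          (expNegH (nextH D H K) B φ - expNegH Ht B φ)) := by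
    refine ContDiff.sum fun B _ => ?_
    exact ((hcdE Ht (U \ B)).mul (hcdE (-Ht) (B \ U))).mul ((hexpd (nextH D H K) B).sub (hexpd Ht B))
  -- the sum of the five bounds
  have s1 := h1.add h2 hF1d hF2d
  have s2 := s1.add h3 (hF1d.add hF2d) hF3d
  have s3 := s2.add h4 ((hF1d.add hF2d).add hF3d) hF4d
  have s4 := s3.add h5 (((hF1d.add hF2d).add hF3d).add hF4d) hF5d
  -- the two decompositions of the same data: tied and free
  have hdec := nextKStep_eq_blockPart_add_remainders_abkm_of_stepKernelBounds (p := p) (r₀ := r₀) (A := A) hd hLodd hL hM hkN hp hpR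
    hMord hB hδ₀ hδ₁ hh hh0 hA D hDs hDL hS hB₀ hc₀ hH hC hK hKfac hK0 hKd hKloc hUne
  have hdecF := nextK_freeHt_eq_blockPart_add_remainders_abkm_of_stepKernelBounds (p := p) (r₀ := r₀) (A := A) hd hLodd hL hM hkN
    hp hpR hMord hB hδ₀ hδ₁ hh hh0 hA D hDs hDL hS hB₀ hc₀ hH Ht hC hK hKfac hK0 hKd hKloc hUne
  have hfun : (fun φ => nextK D.s (reblock D.s (D.L * D.s)) (stepMeasure D.𝒞) (expNegH H) (expNegH Ht) K U φ - nextKStep D H K U φ) =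
      (fun φ => (∑ B ∈ blockPartIndex D U,
        ((bprod (L ^ k) (fun B' => expNegH (Ht) B' φ) (U \ B) *
              bprod (L ^ k) (fun B' => expNegH (-(Ht)) B' φ) (B \ U) - 1) * blockTerm D K B φ +
          bprod (L ^ k) (fun B' => expNegH (Ht) B' φ) (U \ B) *
              bprod (L ^ k) (fun B' => expNegH (-(Ht)) B' φ) (B \ U) *
            (fluctDefect D.𝒞 H B φ +
              (expNegH (stepOpA (gradCov D.𝒞) H) B φ - 1) * (1 - Complex.exp (-(eval (opB D K) B φ))) -
              (Complex.exp (-(eval (opB D K) B φ)) - 1 + eval (opB D K) B φ)) +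
          bprod (L ^ k) (fun B' => expNegH (Ht) B' φ) (U \ B) *
              bprod (L ^ k) (fun B' => expNegH (-(Ht)) B' φ) (B \ U) *
            fluct D.𝒞 (fun ψ => ∑ Y ∈ ((polys (L ^ k) B).erase B).erase ∅,
              bprod (L ^ k) (fun B' => expNegH H B' ψ - 1) (B \ Y) * K Y ψ) φ)) -
        (∑ B ∈ blockPartIndex D U,
        ((bprod (L ^ k) (fun B' => expNegH (nextH D H K) B' φ) (U \ B) *
              bprod (L ^ k) (fun B' => expNegH (-(nextH D H K)) B' φ) (B \ U) - 1) * blockTerm D K B φ +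
          bprod (L ^ k) (fun B' => expNegH (nextH D H K) B' φ) (U \ B) *
              bprod (L ^ k) (fun B' => expNegH (-(nextH D H K)) B' φ) (B \ U) *
            (fluctDefect D.𝒞 H B φ +
              (expNegH (stepOpA (gradCov D.𝒞) H) B φ - 1) * (1 - Complex.exp (-(eval (opB D K) B φ))) -
              (Complex.exp (-(eval (opB D K) B φ)) - 1 + eval (opB D K) B φ)) +
          bprod (L ^ k) (fun B' => expNegH (nextH D H K) B' φ) (U \ B) *
              bprod (L ^ k) (fun B' => expNegH (-(nextH D H K)) B' φ) (B \ U) *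
            fluct D.𝒞 (fun ψ => ∑ Y ∈ ((polys (L ^ k) B).erase B).erase ∅,
              bprod (L ^ k) (fun B' => expNegH H B' ψ - 1) (B \ Y) * K Y ψ) φ))) + (fun φ => ∑ X ∈ largePartIndex (L ^ k) L U,
        ((bprod (L ^ k) (fun B => expNegH (Ht) B φ) (U \ X) * bprod (L ^ k) (fun B => expNegH (-(Ht)) B φ) (X \ U) *
            (fluct D.𝒞 (polyP2 (L ^ k) H K X) φ + bprod (L ^ k) (fun B => 1 - expNegH (Ht) B φ) X)) -
          (bprod (L ^ k) (fun B => expNegH (nextH D H K) B φ) (U \ X) * bprod (L ^ k) (fun B => expNegH (-(nextH D H K)) B φ) (X \ U) *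
            (fluct D.𝒞 (polyP2 (L ^ k) H K X) φ + bprod (L ^ k) (fun B => 1 - expNegH (nextH D H K) B φ) X)))) + (fun φ => ∑ X ∈ ((polys (L ^ k) univ).filter (fun X => reblock (L ^ k) (L * L ^ k) X = U)).filter
          (fun X => ¬ IsConn X),
        ((bprod (L ^ k) (fun B => expNegH (Ht) B φ) (U \ X) * bprod (L ^ k) (fun B => expNegH (-(Ht)) B φ) (X \ U) *
            (fluct D.𝒞 (polyP2 (L ^ k) H K X) φ + bprod (L ^ k) (fun B => 1 - expNegH (Ht) B φ) X)) -
          (bprod (L ^ k) (fun B => expNegH (nextH D H K) B φ) (U \ X) * bprod (L ^ k) (fun B => expNegH (-(nextH D H K)) B φ) (X \ U) *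
            (fluct D.𝒞 (polyP2 (L ^ k) H K X) φ + bprod (L ^ k) (fun B => 1 - expNegH (nextH D H K) B φ) X)))) + (fun φ => ∑ X ∈ (polys (L ^ k) univ).filter (fun X => reblock (L ^ k) (L * L ^ k) X = U),
        ∑ X₁ ∈ ((polys (L ^ k) X).erase X).erase ∅,
        ((bprod (L ^ k) (fun B => expNegH (Ht) B φ) (U \ X) * bprod (L ^ k) (fun B => expNegH (-(Ht)) B φ) (X \ U) *
            (bprod (L ^ k) (fun B => 1 - expNegH (Ht) B φ) X₁ * fluct D.𝒞 (polyP2 (L ^ k) H K (X \ X₁)) φ)) -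
          (bprod (L ^ k) (fun B => expNegH (nextH D H K) B φ) (U \ X) * bprod (L ^ k) (fun B => expNegH (-(nextH D H K)) B φ) (X \ U) *
            (bprod (L ^ k) (fun B => 1 - expNegH (nextH D H K) B φ) X₁ * fluct D.𝒞 (polyP2 (L ^ k) H K (X \ X₁)) φ)))) + (fun φ => ∑ B ∈ blockPartIndex D U,
        bprod (L ^ k) (fun B' => expNegH Ht B' φ) (U \ B) *
            bprod (L ^ k) (fun B' => expNegH (-Ht) B' φ) (B \ U) *
          (expNegH (nextH D H K) B φ - expNegH Ht B φ)) := by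
    funext ψ
    simp only [Pi.add_apply]
    rw [hdec ψ, hdecF ψ]
    simp only [sum_sub_distrib]
    ring
  rw [hfun]
  exact s4

set_option maxHeartbeats 1600000 in
/-- **Raw free-`H̃` bound on a non-empty `(k+1)`-polymer** (module docstring): torus data at scale `k` (`d ≥ 3`, `L` odd,
`L ≥ 2^{d+3}+16R`, `R ≥ 2`, `M = L^N`, `k+1 ≤ N`, `⌊d/2⌋+2 ≤ p`, `p + d ≤ M_ord ≤ R`, `r₀ ≥ 3`), one step kernel with `StepKernelBounds`
(`C₂ ≤ h²`), `‖H‖ ≤ b ≤ 1/64`, `‖K‖ ≤ C` with `C_{8.7}CA_𝒫A^{−1} ≤ 1/64`, `2b + C_{8.7}CA_𝒫A^{−1} ≤ τ ≤ 1/16`, a FREE `H̃` with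
`‖H̃‖_{k,0} ≤ τ`, letters `ω, κ, κ₁` absorbing `Δ_t = 16e^{3/8}‖H̃ − H_{k+1}‖_{k,0}`: the sum of the four one-kernel remainder Lipschitz
constants and the defect constant.  [cite: AdamsBuchholzKoteckyMuller2019, Theorem 6.8 (6.59)–(6.60) / Lemma 9.3 / Lemma 12.6 (12.53)] -/
theorem tayNormLE_nextK_freeHt_sub_nextKStep_abkm_raw_of_stepKernelBounds {L N Mord R n p r₀ : ℕ}
    {θbar lam μ δ₁ δ₀ A𝒫 A𝒫a C₂a h A : ℝ}
    {𝒞 : ℕ → (Fin d → ZMod M) → ℝ} (hd : 3 ≤ d) (hLodd : Odd L) (hL : 2 ^ (d + 3) + 16 * R ≤ L)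
    (hR2 : 2 ≤ R) (hM : M = L ^ N) {k : ℕ} (hkN : k + 1 ≤ N)
    (hp : d / 2 + 2 ≤ p) (hpM : p + d ≤ Mord) (hMR : Mord ≤ R) (hr₀ : 3 ≤ r₀)
    (hB : AbkmWeightBounds L N Mord R n θbar lam μ δ₁ δ₀ A𝒫 𝒞
      (abkmWeightData L N Mord R θbar (schedDelta δ₀ δ₁ N) 𝒞))
    (hδ₀ : 0 < δ₀) (hδ₁ : 0 < δ₁) (hh : 0 < h) (hh0 : hZeroSq d R δ₀ δ₁ ≤ h ^ 2)
    (hh2a : C₂a ≤ h ^ 2) (hA𝒫a : 0 ≤ A𝒫a) (hA1 : 1 ≤ A)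
    (D : StepData d M) (hDs : D.s = L ^ k) (hDL : D.L = L)
    (hS : StepKernelBounds (abkmWeightData L N Mord R θbar (schedDelta δ₀ δ₁ N) 𝒞) L k A𝒫a C₂a D.𝒞)
    {x₀ : Fin d → ZMod M} (hB₀ : D.B₀ = blockOf (L ^ k) x₀) (hc₀ : D.c₀ = boxCorner (L ^ k) (starRad R L d k) x₀)
    {U : Finset (Fin d → ZMod M)} (hU : IsPolymer (L ^ (k + 1)) U) (hUne : U.Nonempty)
    {H : RelevantHamiltonian ℂ d} {b : ℝ}
    (hH : hamNorm (fieldWt h (L : ℝ) d k) ((L : ℝ) ^ k) (L ^ (d * k)) H ≤ b) (hb : b ≤ 1 / 64)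
    {K : Finset (Fin d → ZMod M) → ((Fin d → ZMod M) → ℝ) → ℂ} {C : ℝ} (hC : 0 ≤ C)
    (hK : WeakNormLE (abkmNormParams L N Mord R p r₀ h θbar A (schedDelta δ₀ δ₁ N) 𝒞) k K C)
    (hKfac : Factorises (L ^ k) K) (hK0 : ∀ φ, K ∅ φ = 1) (hKd : ∀ Y, ContDiff ℝ r₀ (K Y))
    (hKloc : ∀ Y, IsPolymer (L ^ k) Y → IsConn Y →
      IsGaugeLocal ((abkmNormParams L N Mord R p r₀ h θbar A (schedDelta δ₀ δ₁ N) 𝒞).gauge k Y) (K Y))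
    (hva : pi2BoundConst d (((2 * R + 2 : ℕ) : ℝ) + ((d / 2 + 1 : ℕ) : ℝ)) * (C * A𝒫a * A⁻¹) ≤ 1 / 64)
    {τ : ℝ} (hτa : 2 * b + pi2BoundConst d (((2 * R + 2 : ℕ) : ℝ) + ((d / 2 + 1 : ℕ) : ℝ)) * (C * A𝒫a * A⁻¹) ≤ τ)
    (hτ : τ ≤ 1 / 16)
    {Ht : RelevantHamiltonian ℂ d} (hHt : hamNorm (fieldWt h (L : ℝ) d k) ((L : ℝ) ^ k) (L ^ (d * k)) Ht ≤ τ)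
    {ω κ κ₁ : ℝ}
    (hω1 : 8 * Real.exp (1 / 4) * τ +
      16 * Real.exp (3 / 8) * hamNorm (fieldWt h (L : ℝ) d k) ((L : ℝ) ^ k) (L ^ (d * k)) (Ht - nextH D H K) ≤ ω)
    (hω2 : 8 * Real.exp (1 / 4) * b + 8 * Real.exp (1 / 4) * b ≤ ω)
    (hω3 : C ≤ ω) (hωA : ω * A ^ 2 ≤ 1)
    (hκ : 1 + Real.exp (1 / 4) + 16 * Real.exp (3 / 8) * hamNorm (fieldWt h (L : ℝ) d k) ((L : ℝ) ^ k) (L ^ (d * k)) (Ht - nextH D H K) ≤ κ)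
    (hκ₁ : 1 + Real.exp (1 / 4) + 16 * Real.exp (3 / 8) * hamNorm (fieldWt h (L : ℝ) d k) ((L : ℝ) ^ k) (L ^ (d * k)) (Ht - nextH D H K) ≤ κ₁)
    (hκ₁' : 1 + Real.exp (1 / 4) + 16 * Real.exp (3 / 8) * τ ≤ κ₁) :
    TayNormLE ((abkmNormParams L N Mord R p r₀ h θbar A (schedDelta δ₀ δ₁ N) 𝒞).gauge (k + 1) U) r₀
      ((abkmWeightData L N Mord R θbar (schedDelta δ₀ δ₁ N) 𝒞).weight (k + 1) U)
      (fun φ => nextK D.s (reblock D.s (D.L * D.s)) (stepMeasure D.𝒞) (expNegH H) (expNegH Ht) K U φ - nextKStep D H K U φ)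
      (
      ((blocks (L ^ k) U).card * κ₁ ^ (blocks (L ^ k) U).card *
        (16 * Real.exp (3 / 8) * hamNorm (fieldWt h (L : ℝ) d k) ((L : ℝ) ^ k) (L ^ (d * k)) (Ht - nextH D H K) *
            ((1 + 8 * pi2BoundConst d (((2 * R + 2 : ℕ) : ℝ) + ((d / 2 + 1 : ℕ) : ℝ))) * (C * A𝒫a * A⁻¹) +
              256 * Real.exp (1 / 4) * ((A𝒫a + 4) * b ^ 2 +
                2 * b * (pi2BoundConst d (((2 * R + 2 : ℕ) : ℝ) + ((d / 2 + 1 : ℕ) : ℝ)) * (C * A𝒫a * A⁻¹)) +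
                (pi2BoundConst d (((2 * R + 2 : ℕ) : ℝ) + ((d / 2 + 1 : ℕ) : ℝ)) * (C * A𝒫a * A⁻¹)) ^ 2)) +
          16 * Real.exp (3 / 8) * τ *
            ((1 + 8 * pi2BoundConst d (((2 * R + 2 : ℕ) : ℝ) + ((d / 2 + 1 : ℕ) : ℝ))) * ((0 : ℝ) * A𝒫a * A⁻¹)) +
          (512 * Real.exp (1 / 4) * (A𝒫a + 4) * (b + b) *
              hamNorm (fieldWt h (L : ℝ) d k) ((L : ℝ) ^ k) (L ^ (d * k)) (H - H) +
            512 * Real.exp (1 / 4) *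
              (hamNorm (fieldWt h (L : ℝ) d k) ((L : ℝ) ^ k) (L ^ (d * k)) (H - H) *
                  (pi2BoundConst d (((2 * R + 2 : ℕ) : ℝ) + ((d / 2 + 1 : ℕ) : ℝ)) * (C * A𝒫a * A⁻¹)) +
                b * (pi2BoundConst d (((2 * R + 2 : ℕ) : ℝ) + ((d / 2 + 1 : ℕ) : ℝ)) * ((0 : ℝ) * A𝒫a * A⁻¹))) +
            256 * Real.exp (1 / 4) *
              (pi2BoundConst d (((2 * R + 2 : ℕ) : ℝ) + ((d / 2 + 1 : ℕ) : ℝ)) * (C * A𝒫a * A⁻¹) +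
                pi2BoundConst d (((2 * R + 2 : ℕ) : ℝ) + ((d / 2 + 1 : ℕ) : ℝ)) * ((0 : ℝ) * A𝒫a * A⁻¹)) *
              (pi2BoundConst d (((2 * R + 2 : ℕ) : ℝ) + ((d / 2 + 1 : ℕ) : ℝ)) * ((0 : ℝ) * A𝒫a * A⁻¹))))) +
      (κ ^ (blocks (L ^ k) U).card *
          ((3 * (16 * Real.exp (3 / 8) * hamNorm (fieldWt h (L : ℝ) d k) ((L : ℝ) ^ k) (L ^ (d * k)) (Ht - nextH D H K)) +
              16 * Real.exp (3 / 8) * hamNorm (fieldWt h (L : ℝ) d k) ((L : ℝ) ^ k) (L ^ (d * k)) (H - H) + (0 : ℝ)) *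
            (ω * A ^ 4)) *
        (((2 * (2 * κ * max 1 A𝒫a)) ^ ((2 ^ (d + 1) + 2) ^ d * L ^ d) * (4 : ℝ) ^ ((2 ^ (d + 1) + 2) ^ d * L ^ d)) ^
            (blocks (L * L ^ k) U).card *
          A ^ (-((1 + 1 / ((2 * (2 ^ d + 1) + 6 : ℝ) ^ d)) * (blocks (L * L ^ k) U).card) : ℝ)) +
      κ ^ (blocks (L ^ k) U).card *
          (2 * (16 * Real.exp (3 / 8) * hamNorm (fieldWt h (L : ℝ) d k) ((L : ℝ) ^ k) (L ^ (d * k)) (Ht - nextH D H K)) + (0 : ℝ)) *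
        (((2 * κ * max 1 A𝒫a) ^ ((2 ^ (d + 1) + 2) ^ d * L ^ d) * (2 : ℝ) ^ ((2 ^ (d + 1) + 2) ^ d * L ^ d)) ^
            (blocks (L * L ^ k) U).card *
          A ^ (-((1 + 1 / ((2 * (2 ^ d + 1) + 6 : ℝ) ^ d)) * (blocks (L * L ^ k) U).card) : ℝ))) +
      (κ ^ (blocks (L ^ k) U).card *
          ((3 * (16 * Real.exp (3 / 8) * hamNorm (fieldWt h (L : ℝ) d k) ((L : ℝ) ^ k) (L ^ (d * k)) (Ht - nextH D H K)) +
              16 * Real.exp (3 / 8) * hamNorm (fieldWt h (L : ℝ) d k) ((L : ℝ) ^ k) (L ^ (d * k)) (H - H) + (0 : ℝ)) *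
            (ω * A ^ 4)) *
        (((2 * (2 * κ * max 1 A𝒫a)) ^ ((2 ^ (d + 1) + 2) ^ d * L ^ d) * (4 : ℝ) ^ ((2 ^ (d + 1) + 2) ^ d * L ^ d)) ^
            (blocks (L * L ^ k) U).card *
          A ^ (-((1 + 1 / ((2 * (2 ^ d + 1) + 6 : ℝ) ^ d)) * (blocks (L * L ^ k) U).card) : ℝ))) +
      (κ ^ (blocks (L ^ k) U).card *
          ((3 * (16 * Real.exp (3 / 8) * hamNorm (fieldWt h (L : ℝ) d k) ((L : ℝ) ^ k) (L ^ (d * k)) (Ht - nextH D H K)) +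
              16 * Real.exp (3 / 8) * hamNorm (fieldWt h (L : ℝ) d k) ((L : ℝ) ^ k) (L ^ (d * k)) (H - H) + (0 : ℝ)) *
            (ω * A ^ 4)) *
        (((2 * (2 * κ * max 1 A𝒫a)) ^ ((2 ^ (d + 1) + 2) ^ d * L ^ d) * (4 : ℝ) ^ ((2 ^ (d + 1) + 2) ^ d * L ^ d)) ^
            (blocks (L * L ^ k) U).card *
          A ^ (-((1 + 1 / ((2 * (2 ^ d + 1) + 6 : ℝ) ^ d)) * (blocks (L * L ^ k) U).card) : ℝ))) +
      ((blocks (L ^ k) U).card * κ₁ ^ (blocks (L ^ k) U).card *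
        (16 * Real.exp (3 / 8) *
          hamNorm (fieldWt h (L : ℝ) d k) ((L : ℝ) ^ k) (L ^ (d * k)) (nextH D H K - Ht)))) := by
  set P := abkmNormParams L N Mord R p r₀ h θbar A (schedDelta δ₀ δ₁ N) 𝒞 with hP
  -- sizes and derived hypotheses
  have hd2 : 2 ≤ d := by omega
  have hp1 : d / 2 + 1 ≤ p := by omega
  have hpR : p ≤ R := by omega
  have hMord : d / 2 + 1 ≤ Mord := by omega
  have hr₀2 : 2 ≤ r₀ := by omega
  have hL0 : (0 : ℝ) < L := by exact_mod_cast hLodd.pos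
  have hA0 : 0 < A := by linarith
  have h𝔥 : 0 < fieldWt h (L : ℝ) d k := fieldWt_pos hh hL0 d k
  have hRk : (0 : ℝ) < (L : ℝ) ^ k := by positivity
  have hnn : ∀ G : RelevantHamiltonian ℂ d, 0 ≤ hamNorm (fieldWt h (L : ℝ) d k) ((L : ℝ) ^ k) (L ^ (d * k)) G := fun G => hamNorm_nonneg h𝔥.le hRk.le _ _
  have hb0 : 0 ≤ b := (hnn H).trans hH
  have hH64 : hamNorm (fieldWt h (L : ℝ) d k) ((L : ℝ) ^ k) (L ^ (d * k)) H ≤ 1 / 64 := hH.trans hb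
  have hH16 : hamNorm (fieldWt h (L : ℝ) d k) ((L : ℝ) ^ k) (L ^ (d * k)) H ≤ 1 / 16 := hH64.trans (by norm_num)
  have hH8 : hamNorm (fieldWt h (L : ℝ) d k) ((L : ℝ) ^ k) (L ^ (d * k)) H ≤ 1 / 8 := hH64.trans (by norm_num)
  have hHH : hamNorm (fieldWt h (L : ℝ) d k) ((L : ℝ) ^ k) (L ^ (d * k)) (H - H) = 0 := by rw [sub_self, hamNorm_zero]
  -- the extracted Hamiltonian `H_{k+1} = nextH D H K`
  have hHta : hamNorm (fieldWt h (L : ℝ) d k) ((L : ℝ) ^ k) (L ^ (d * k)) (nextH D H K) ≤ τ :=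
    (hamNorm_nextH_abkm_le_of_stepKernelBounds hd2 hLodd hL hM hkN hp1 hpR hr₀2 hB hh hh2a hA1 D hS hB₀ hc₀ H hC hK hKd
      hKloc).trans (by linarith [hH])
  have hHta16 : hamNorm (fieldWt h (L : ℝ) d k) ((L : ℝ) ^ k) (L ^ (d * k)) (nextH D H K) ≤ 1 / 16 := hHta.trans hτ
  have hHt16 : hamNorm (fieldWt h (L : ℝ) d k) ((L : ℝ) ^ k) (L ^ (d * k)) Ht ≤ 1 / 16 := hHt.trans hτ
  -- `K − K` has weak norm `0`
  have hKK : WeakNormLE P k (K - K) 0 := by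
    intro X hX hc φ
    have hz : (K - K) X = fun _ => (0 : ℂ) := by funext ψ; simp
    rw [hz, tayNorm_const, norm_zero]
    exact mul_nonneg (mul_nonneg le_rfl (WeakNormLE.aFactor_pos hA0 k X).le) ((abkmWeightData L N Mord R θbar (schedDelta δ₀ δ₁ N) 𝒞).weight_pos k X φ).le
  have hCΔ : (0 : ℝ) ≤ 0 := le_rfl
  -- letters
  have hbω : 8 * Real.exp (1 / 4) * hamNorm (fieldWt h (L : ℝ) d k) ((L : ℝ) ^ k) (L ^ (d * k)) H ≤ ω := by
    have : 8 * Real.exp (1 / 4) * hamNorm (fieldWt h (L : ℝ) d k) ((L : ℝ) ^ k) (L ^ (d * k)) H ≤ 8 * Real.exp (1 / 4) * b := mul_le_mul_of_nonneg_left hH (by positivity)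
    have : 0 ≤ 8 * Real.exp (1 / 4) * b := by positivity
    linarith
  have hb'ω : 8 * Real.exp (1 / 4) * hamNorm (fieldWt h (L : ℝ) d k) ((L : ℝ) ^ k) (L ^ (d * k)) H + 16 * Real.exp (3 / 8) * hamNorm (fieldWt h (L : ℝ) d k) ((L : ℝ) ^ k) (L ^ (d * k)) (H - H) ≤ ω := by
    rw [hHH, mul_zero, add_zero]; exact hbω
  have hCω : C + (0 : ℝ) ≤ ω := by linarith
  have hκ₁'' : 1 + Real.exp (1 / 4) ≤ κ₁ := by
    have : 0 ≤ 16 * Real.exp (3 / 8) * τ := by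
      have := (hnn Ht).trans hHt
      positivity
    linarith
  -- the five pieces
  have h1 := tayNormLE_remainderOne_sub_abkm_of_stepKernelBounds (p := p) (r₀ := r₀) (A := A) hd hLodd hL hR2 hM hkN hp1 hpR hMord
    hr₀2 hB hδ₀ hδ₁ hh hh0 hh2a hA𝒫a hA1 D hDs hDL hS hB₀ hc₀ hU hHt hHta hτ hH hH hb hC hCΔ hK hK hKK hKd hKd hKloc hKloc
    hva hκ₁ hκ₁'
  have h2 := tayNormLE_remainderTwoLarge_sub_abkm_of_stepKernelBounds (n := n) (lam := lam) (μ := μ) hd hLodd hL hR2 hM hkN hS hp1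
    hMord hB hδ₀ hδ₁ hh hh0 hA𝒫a hA1 hU hHt hHta hτ hH16 hH16 hC hCΔ hK hK hKK hKfac hK0 hKd hKfac hK0 hKd hKloc hKloc
    hω1 hbω hb'ω hCω hωA hκ
  have h3 := tayNormLE_remainderThree_sub_abkm_of_stepKernelBounds (n := n) (lam := lam) (μ := μ) hd hLodd hL hR2 hM hkN hS hp1
    hMord hB hδ₀ hδ₁ hh hh0 hA𝒫a hA1 hU hUne hHt hHta hτ hH16 hH16 hC hCΔ hK hK hKK hKfac hK0 hKd hKfac hK0 hKd hKloc hKloc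
    hω1 hbω hb'ω hCω hωA hκ
  have h4 := tayNormLE_remainderFour_sub_abkm_of_stepKernelBounds (n := n) (lam := lam) (μ := μ) hd hLodd hL hR2 hM hkN hS hp1
    hMord hB hδ₀ hδ₁ hh hh0 hA𝒫a hA1 hU hHt hHta hτ hH16 hH16 hC hCΔ hK hK hKK hKfac hK0 hKd hKfac hK0 hKd hKloc hKloc
    hω1 hbω hb'ω hCω hωA hκ
  have h5 := tayNormLE_blockDefect_sub_abkm (n := n) (lam := lam) (μ := μ) (A𝒫 := A𝒫) (p := p) (r₀ := r₀) (A := A) hd hLodd hL hR2 hM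
    hkN hp1 hMord hB hδ₀ hδ₁ hh hh0 D hDs hDL hU (Ht := Ht) (H₁ := nextH D H K) (H₂ := Ht) hHt hτ hHta16 hHt16 hκ₁''
  exact tayNormLE_nextK_freeHt_sub_nextKStep_of_pieces (n := n) (lam := lam) (μ := μ) hd2 hLodd hL hM hkN hp1 hpR hMord hB hδ₀ hδ₁ hh
    hh0 hA0 D hDs hDL hS hB₀ hc₀ hH8 Ht hC hK hKfac hK0 hKd hKloc hUne h1 h2 h3 h4 h5

end Literature.MathematicalPhysics.StatisticalMechanics.GradientRG

end
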